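/-
Copyright (c) 2026 the pub-hodgecm-mathlib formalisation cell (harness21).  Prover seat hodgecm-mathlib-F0P2-p01 (g17): road «S3-ram» (LEAD F0P3a-plan (g13);
owner F0P3a-p06), (Cnt2′) route B (chair F0P3a-p07 (g15) RULINGS (16)(c)∕(18)), organ «(K2-aniso) THE ANISOTROPIC ROOT PACKAGE FROM VALUE-ONLY LINE COUNTS», lattice half; 2026-09-02.
-/
import Literature.NumberTheory.Rogawski1990.DepthZeroKappaTransferTypeTwoRamifiedHyperbolicRootSlices   -- ★ p849311∕p849330 (F0P3a-p01 (g18)): the HYPERBOLIC twin (shape of §3∕§4 here), `exists_v_vecTwo_eq_one_of_isotropic`; brings ★ (K2) `offRegion_tokenSlices_of_lineCounts_of_odd` (A-p12), ★ `v_det_le_of_entries_le_of_mulVec_le`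
import Literature.NumberTheory.Automorphic.UnitaryLatticeTreeAnisotropicBlockRootRegion                -- ★ p848920 (F0P3a-p08 (g20)): THM 4 `eq_root_of_latticeGraphIso_selfDual_lev_of_coe_eq_conj_endoGL` (root region `{r₀}`), `endoGL_sub_smul_one_mulVec_eq`, `exists_valued_eq_one_of_pairing_self_eq_one`; brings ★ AnisotropicPlane
import HarnessLib

/-!
# The ramified `κ`-orbital integral, ROUTE B: THE ROOT CENSUS OF THE ANISOTROPIC TYPE-(2) LITERAL FROM VALUE-ONLY LINE COUNTS (lattice half, any odd root depth)
# (Kottwitz 1986 §3; Rogawski 1990 §4.9; Labesse–Langlands 1979 §2; Bruhat–Tits 1972 §10)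

Topic `NumberTheory/Rogawski1990`; namespace `Literature.NumberTheory.Rogawski1990.TypeOneRamifiedJunction` (the raw head's namespace).  THEOREMS ONLY (no definition, no
instance, no notation, no named fact, no `sorry`); kernel lane `--supports stmt-HodgeConjecture-24833`; datum-free (`K` with `Valued K ℤᵐ⁰`).  Cell `pub/hodgecm-mathlib`
(D-0151), crux H413; road «S3-ram» (count-neutral); (Cnt2′) ROUTE B, chair F0P3a-p07 (g15) RULING (18): the A-ODD ∕ C cells `stub_Zaniso_zero_odd_A` (pen A-p16 (g33)) and
`stub_Zpair_pm_odd_A` (assembler F0P3-p01 (g19)) want, for the ANISOTROPIC literal `γ = P·ι(γ₁, u)·P⁻¹ ∈ K₀` of the `J₀`-model (frame `ᵗσ(P)J₀P = ι(diag d, η)` with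
`diag d̄` anisotropic, `P·L₀ = L₀`), exactly what ★ `rootSlices_hyperbolic_of_lineCounts` ∕ ★ `rootRegionPackage_hyperbolic_of_lineCounts` (F0P3a-p01 (g18)) give for the
hyperbolic literal `ι(B₀, 1)`: the root's three grandchild slices `(NE, NP, NM) = q·(νE, νP, νM)` from VALUE-ONLY child-line counts, and the root region `{r₀}`.  This file is
that twin; it is REGIME-AGNOSTIC (odd root depth `d₀ ≥ 3`: regime B and regimes A-odd ∕ C alike), the only literal-specific input being the NON-CONTRACTION `hT` of
`T = γ₁ − u₀₀·1` on primitive vectors (★ `nonContraction_of_unitary_anisotropic_of_entry`, F0P3a-p08: automatic for a unitary anisotropic `γ₁` with rootless `χ_{γ₁}` once ONE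
entry of `T` has valuation `≥ |ϖ|^{d₀}`, e.g. from `|det T| = |ϖ|^{2d₀}`).

THE MATHEMATICS.  §1 **NO CHILD LINE OF THE ANISOTROPIC ROOT IS A RESIDUAL EIGENLINE** (`not_eigenline_root_of_coe_eq_conj_endoGL`): if the first-order eigenline test of ★ (K2)
held for `κ ∈ K₀` (`|M₁₀|, |M₂₀| ≤ |ϖ|^{d₀+1}`, `M = κ⁻¹(γ−1)κ`), then `(γ − 1 − λ)x ∈ ϖ^{d₀+1}𝒪³` for the primitive isotropic `x = κe₀` and `λ = M₀₀`; in the block frame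
`x′ = P⁻¹x` is primitive and `ι(diag d, η)`-isotropic, so — `diag d̄` being ANISOTROPIC — `x′₁` is a unit and `x′_W` is primitive; the line row of `ι(γ₁,u) − 1 − λ` gives
`λ ≡ u₀₀ − 1 (mod ϖ^{d₀+1})`, whence `T·x′_W = (γ₁ − u₀₀·1)x′_W ∈ ϖ^{d₀+1}𝒪²`, contradicting `hT`.  §2 **THE THREE ROOT SLICES FROM VALUE-ONLY LINE COUNTS**
(`rootSlices_anisotropic_of_lineCounts`): ★ (K2) `offRegion_tokenSlices_of_lineCounts_of_odd` at `v = r₀`, `u = 1`, with the eigenline clause REMOVED by §1 — the `hNE hNP hNM`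
binders of ★ `strataCount_J₀_of_charpoly_block_raw_singleton` with `(NE, NP, NM) = q·(νE, νP, νM)`, `νX` = the number of child lines `κ·N₁` (`κ ∈ K₀`) whose value
`(ϖ^{d₀})⁻¹⟨κe₀, (γ−1)κe₀⟩` is null ∕ of class `−c₁` ∕ of class `−c₁ε` — the `hνE hνP hνM` texts of ★ p849311 CHARACTER FOR CHARACTER (so ★ p849383
`ncard_rootChildren_{null,class,negClass}_eq_natCard`, generic in `γ`, converts them to residual-conic point counts).  §3 **THE ROOT-REGION PACKAGE**
(`rootRegionPackage_anisotropic_of_lineCounts`): §2 + ★ F0P3a-p08's THM 4 `eq_root_of_latticeGraphIso_selfDual_lev_of_coe_eq_conj_endoGL` (`R = {r₀}`) packaged as the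
`(sR := {r₀}, hsR, PE PP PM, hPE hPP hPM)` inputs of ★ p849224 ∕ ★ p849189 ∕ ★ p849287, shape of ★ p849330 §5.
HONEST LABEL: HC_CM is proved only modulo the 2 remaining named inputs (hLiu418 24832, h413 24833) until rung 0 closes; nothing printed is asserted here (lattice bookkeeping over ★
results); «S3-ram» is Literature seeding, count-neutral.

## References
* [Kottwitz1986] R. E. Kottwitz, *Base change for unit elements of Hecke algebras*, Compositio Math. 60 (1986), §3 (counting fixed lattices shell by shell).
* [Rogawski1990] J. D. Rogawski, *Automorphic Representations of Unitary Groups in Three Variables*, Ann. of Math. Stud. 123 (1990), §4.8 Case (a) p. 53, §4.9 pp. 54–56, Prop. 4.9.1.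
* [LabesseLanglands1979] J.-P. Labesse, R. P. Langlands, *L-indistinguishability for SL(2)*, Canad. J. Math. 31 (1979), §2 (κ-signed counts over the four literals).
* [BruhatTits1972] F. Bruhat, J. Tits, *Groupes réductifs sur un corps local I*, Publ. Math. IHÉS 41 (1972), §10 (lattice models of the building).
* [Serre1980Trees] J.-P. Serre, *Trees* (1980), I.2.3, II.1.1.
-/

set_option autoImplicit false

noncomputable section

open scoped Valued WithZero Matrix MatrixGroups
open Polynomial Classical SimpleGraph
open Literature.NumberTheory.Automorphic Literature.NumberTheory.Automorphic.HermitianLattice Literature.NumberTheory.Automorphic.UnitaryLatticeTree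

namespace Literature.NumberTheory.Rogawski1990.TypeOneRamifiedJunction

variable {K : Type*} [Field K] [Valued K ℤᵐ⁰] {σ : K →+* K} {ϖ : K}

/-! ## §1 No child line of the anisotropic root is a residual eigenline -/

set_option maxHeartbeats 800000 in -- budget only: block tokens.
/-- **NO EIGENLINE CHILD AT THE ANISOTROPIC ROOT.**  `γ ∈ U(σ, Φ₃)` with matrix `P·ι(γ₁, u)·P⁻¹`, `ᵗσ(P)Φ₃P = ι(diag d, η)` (`|dᵢ| = |η| = 1`, `diag d̄` ANISOTROPIC), `P·𝒪³ = 𝒪³`,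
and the NON-CONTRACTION `hT` of `T = γ₁ − u₀₀·1` at depth `d₀` (every primitive `y ∈ 𝒪²` has a coordinate of `T·y` of valuation `≥ |ϖ|^{d₀}`).  Then for every `κ ∈ K₀` the
first-order eigenline test of ★ (K1)∕(K2) FAILS: `¬ (|M₁₀| ≤ |ϖ|^{d₀+1} ∧ |M₂₀| ≤ |ϖ|^{d₀+1})`, `M = κ⁻¹(γ−1)κ` — the block-frame child `x′ = P⁻¹κe₀` is primitive and isotropic,
so `x′₁` is a unit and `x′_W` is primitive, the line row forces `λ ≡ u₀₀ − 1`, and `T·x′_W ∈ ϖ^{d₀+1}𝒪²` contradicts `hT`.  (Twin of ★ `not_eigenline_root_of_lt_v_det`.)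
[cite: Kottwitz1986, §3] [cite: BruhatTits1972, §10] [cite: LabesseLanglands1979, §2] [cite: Rogawski1990, §4.8 Case (a) p. 53] -/
theorem not_eigenline_root_of_coe_eq_conj_endoGL (hvσ : ∀ a, Valued.v (σ a) = Valued.v a) (hϖ : Valued.v ϖ = WithZero.exp (-1 : ℤ))
    {d : Fin 2 → K} {η : K} (P : GL (Fin 3) K)
    (hP : formCongr σ P ((StdForm.antidiagonal 3).over K) =
      !![(Matrix.diagonal d) 0 0, 0, (Matrix.diagonal d) 0 1; 0, η, 0; (Matrix.diagonal d) 1 0, 0, (Matrix.diagonal d) 1 1])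
    (hP0 : mapGL P (stdLattice K 3) = stdLattice K 3)
    (hanis₀ : ∀ c : K, Valued.v c ≤ 1 → Valued.v (d 0 + d 1 * (σ c * c)) = 1)
    (hanis₁ : ∀ c : K, Valued.v c ≤ 1 → Valued.v (d 0 * (σ c * c) + d 1) = 1)
    (hη : Valued.v η = 1)
    {γ : unitaryGroupOfForm σ ((StdForm.antidiagonal 3).over K)} (γ₁ : GL (Fin 2) K) (u : GL (Fin 1) K)
    (hγ : (γ : GL (Fin 3) K) = P * endoGL (γ₁, u) * P⁻¹) {d₀ : ℕ}
    (hT : ∀ y : Fin 2 → K, (∀ i, Valued.v (y i) ≤ 1) → (∃ i, Valued.v (y i) = 1) →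
      ∃ i, Valued.v ϖ ^ d₀ ≤ Valued.v ((((γ₁ : Matrix (Fin 2) (Fin 2) K) - (u : Matrix (Fin 1) (Fin 1) K) 0 0 • (1 : Matrix (Fin 2) (Fin 2) K)) *ᵥ y) i))
    (κ : unitaryGroupOfForm σ ((StdForm.antidiagonal 3).over K)) (hκ : κ ∈ unitaryInt σ ((StdForm.antidiagonal 3).over K)) :
    ¬ (Valued.v (((((((κ : unitaryGroupOfForm σ ((StdForm.antidiagonal 3).over K)) : GL (Fin 3) K))⁻¹ : GL (Fin 3) K) : Matrix (Fin 3) (Fin 3) K) * (((γ : GL (Fin 3) K) : Matrix (Fin 3) (Fin 3) K) - 1) * (((κ : unitaryGroupOfForm σ ((StdForm.antidiagonal 3).over K)) : GL (Fin 3) K) : Matrix (Fin 3) (Fin 3) K)) 1 0) ≤ Valued.v ϖ ^ (d₀ + 1) ∧ Valued.v (((((((κ : unitaryGroupOfForm σ ((StdForm.antidiagonal 3).over K)) : GL (Fin 3) K))⁻¹ : GL (Fin 3) K) : Matrix (Fin 3) (Fin 3) K) * (((γ : GL (Fin 3) K) : Matrix (Fin 3) (Fin 3) K) - 1) * (((κ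 : unitaryGroupOfForm σ ((StdForm.antidiagonal 3).over K)) : GL (Fin 3) K) : Matrix (Fin 3) (Fin 3) K)) 2 0) ≤ Valued.v ϖ ^ (d₀ + 1)) := by
  rintro ⟨h10, h20⟩
  have hϖ0' : Valued.v ϖ ≠ 0 := by rw [hϖ]; exact WithZero.exp_ne_zero
  have hϖ0 : ϖ ≠ 0 := fun h0 => by rw [h0, map_zero] at hϖ0'; exact hϖ0' rfl
  have hϖ1 : Valued.v ϖ < 1 := by rw [hϖ, ← WithZero.exp_zero]; exact WithZero.exp_lt_exp.2 (by norm_num)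
  have hϖd1 : Valued.v ϖ ^ (d₀ + 1) < Valued.v ϖ ^ d₀ := pow_lt_pow_right_of_lt_one₀ (zero_lt_iff.2 hϖ0') hϖ1 (by omega)
  -- an integral matrix does not increase the sup-bound of a vector
  have hmv : ∀ (A : Matrix (Fin 3) (Fin 3) K) (z : Fin 3 → K) (t : ℤᵐ⁰), (∀ i j, Valued.v (A i j) ≤ 1) → (∀ j, Valued.v (z j) ≤ t) →
      ∀ i, Valued.v ((A *ᵥ z) i) ≤ t := by
    intro A z t hA hz i
    rw [Matrix.mulVec, dotProduct]
    refine Valuation.map_sum_le _ fun j _ => ?_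
    rw [map_mul]; exact (mul_le_of_le_one_left zero_le (hA i j)).trans (hz j)
  obtain ⟨hκi, hκi'⟩ := mem_unitaryInt_iff.1 hκ
  obtain ⟨hPi, hPi'⟩ := (mapGL_stdLattice_eq_iff P).1 hP0
  set κm : Matrix (Fin 3) (Fin 3) K := ((κ : GL (Fin 3) K) : Matrix (Fin 3) (Fin 3) K) with hκmdef
  set κi : Matrix (Fin 3) (Fin 3) K := ((((κ : GL (Fin 3) K))⁻¹ : GL (Fin 3) K) : Matrix (Fin 3) (Fin 3) K) with hκidef
  set Pmat : Matrix (Fin 3) (Fin 3) K := ((P : GL (Fin 3) K) : Matrix (Fin 3) (Fin 3) K) with hPmatdef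
  set Pinv : Matrix (Fin 3) (Fin 3) K := (((P⁻¹ : GL (Fin 3) K)) : Matrix (Fin 3) (Fin 3) K) with hPinvdef
  set Γm : Matrix (Fin 3) (Fin 3) K := ((endoGL (γ₁, u) : GL (Fin 3) K) : Matrix (Fin 3) (Fin 3) K) with hΓmdef
  set S : Matrix (Fin 3) (Fin 3) K := (((γ : GL (Fin 3) K) : Matrix (Fin 3) (Fin 3) K) - 1) with hSdef
  set M : Matrix (Fin 3) (Fin 3) K := κi * S * κm with hMdef
  -- the line vector `x = κe₀`: integral, with a unit coordinate, isotropic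
  set x : Fin 3 → K := κm *ᵥ (Pi.single 0 1 : Fin 3 → K) with hxdef
  have hxcol : ∀ i, x i = κm i 0 := fun i => by rw [hxdef, Matrix.mulVec_single_one]; rfl
  have hx : ∀ i, Valued.v (x i) ≤ 1 := fun i => by rw [hxcol]; exact hκi i 0
  have hκκ : κi * κm = 1 := by rw [hκidef, hκmdef, ← Units.val_mul, inv_mul_cancel, Units.val_one]
  have hunit : ∃ i, Valued.v (x i) = 1 := by
    by_contra hno
    have hlt : ∀ i, Valued.v (x i) ≤ Valued.v ϖ := fun i => by
      rw [hϖ]; exact (v_lt_one_iff _).1 (lt_of_le_of_ne (hx i) (fun h => hno ⟨i, h⟩))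
    have e1 : (κi *ᵥ x) 0 = 1 := by
      rw [hxdef, Matrix.mulVec_mulVec, hκκ, Matrix.one_mulVec]; simp
    have hle : Valued.v ((κi *ᵥ x) 0) ≤ Valued.v ϖ := hmv κi x _ hκi' hlt 0
    rw [e1, map_one] at hle
    exact absurd hle (not_le.2 hϖ1)
  have hiso : pairing σ ((StdForm.antidiagonal 3).over K) x x = 0 := by
    rw [hxdef, pairing_mulVec_mulVec_of_mem_unitary κ.2, antidiagonal_three_over_eq_endoShape, pairing_endoShape_apply, pairing_antidiag_two_apply]
    simp
  -- entries of `M = κ⁻¹Sκ`; `S x = κ (M e₀)` and `M e₀ = λ e₀ + (0, M₁₀, M₂₀)`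
  have hSx : S *ᵥ x = κm *ᵥ (M *ᵥ (Pi.single 0 1 : Fin 3 → K)) := by
    rw [hxdef, Matrix.mulVec_mulVec, Matrix.mulVec_mulVec, hMdef, ← Matrix.mul_assoc, ← Matrix.mul_assoc, hκmdef, hκidef, ← Units.val_mul, mul_inv_cancel, Units.val_one,
      Matrix.one_mul]
  set lam : K := M 0 0 with hlamdef
  have hMe : M *ᵥ (Pi.single 0 1 : Fin 3 → K) = lam • (Pi.single 0 1 : Fin 3 → K) + ![0, M 1 0, M 2 0] := by
    ext i; rw [Matrix.mulVec_single_one]; fin_cases i <;> simp [hlamdef]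
  have hr : ∀ i, Valued.v ((S *ᵥ x - lam • x) i) ≤ Valued.v ϖ ^ (d₀ + 1) := by
    have e : S *ᵥ x - lam • x = κm *ᵥ ![0, M 1 0, M 2 0] := by
      rw [hSx, hMe, Matrix.mulVec_add, Matrix.mulVec_smul, ← hxdef, add_sub_cancel_left]
    intro i
    rw [e]
    refine hmv κm _ _ hκi (fun j => ?_) i
    fin_cases j
    · simp
    · simpa using h10
    · simpa using h20
  -- the block-frame child `x′ = P⁻¹x`: integral, primitive, `ι(diag d, η)`-isotropic
  obtain ⟨x', hx'def⟩ : ∃ x' : Fin 3 → K, x' = Pinv *ᵥ x := ⟨_, rfl⟩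
  have hPP : Pmat * Pinv = 1 := by rw [hPmatdef, hPinvdef, ← Units.val_mul, mul_inv_cancel, Units.val_one]
  have hPP' : Pinv * Pmat = 1 := by rw [hPmatdef, hPinvdef, ← Units.val_mul, inv_mul_cancel, Units.val_one]
  have hxx' : x = Pmat *ᵥ x' := by rw [hx'def, Matrix.mulVec_mulVec, hPP, Matrix.one_mulVec]
  have hx' : ∀ i, Valued.v (x' i) ≤ 1 := fun i => by rw [hx'def]; exact hmv Pinv x 1 hPi' hx i
  have hunit' : ∃ i, Valued.v (x' i) = 1 := by
    by_contra hno
    have hlt : ∀ i, Valued.v (x' i) ≤ Valued.v ϖ := fun i => by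
      rw [hϖ]; exact (v_lt_one_iff _).1 (lt_of_le_of_ne (hx' i) (fun h => hno ⟨i, h⟩))
    obtain ⟨i, hi⟩ := hunit
    have hle : Valued.v (x i) ≤ Valued.v ϖ := by rw [hxx']; exact hmv Pmat x' _ hPi hlt i
    rw [hi] at hle
    exact absurd hle (not_le.2 hϖ1)
  have hiso' : pairing σ (!![(Matrix.diagonal d) 0 0, 0, (Matrix.diagonal d) 0 1; 0, η, 0; (Matrix.diagonal d) 1 0, 0, (Matrix.diagonal d) 1 1] : Matrix (Fin 3) (Fin 3) K) x' x' = 0 := by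
    rw [← hP, ← pairing_mulVec_mulVec, ← hPmatdef, ← hxx']; exact hiso
  -- block anisotropy: `x′₁` is a unit and `x′_W` is primitive
  have hzz : pairing σ (!![(Matrix.diagonal d) 0 0, 0, (Matrix.diagonal d) 0 1; 0, η, 0; (Matrix.diagonal d) 1 0, 0, (Matrix.diagonal d) 1 1] : Matrix (Fin 3) (Fin 3) K) x' x' =
      pairing σ (Matrix.diagonal d) ![x' 0, x' 2] ![x' 0, x' 2] + σ (x' 1) * η * x' 1 := by
    simp only [pairing_apply, Fin.sum_univ_three, Fin.sum_univ_two, Matrix.diagonal_apply_eq,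
      Matrix.diagonal_apply_ne _ (show (0 : Fin 2) ≠ 1 by decide), Matrix.diagonal_apply_ne _ (show (1 : Fin 2) ≠ 0 by decide),
      Matrix.of_apply, Matrix.cons_val', Matrix.cons_val_zero, Matrix.cons_val_one, Matrix.cons_val_two, Matrix.empty_val', Matrix.cons_val_fin_one,
      Matrix.head_cons, Matrix.tail_cons, Matrix.head_fin_const]
    ring
  have hNeq : pairing σ (Matrix.diagonal d) ![x' 0, x' 2] ![x' 0, x' 2] = -(σ (x' 1) * η * x' 1) := by
    rw [hzz] at hiso'; exact eq_neg_of_add_eq_zero_left hiso'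
  have hW1 : ∀ i, Valued.v ((![x' 0, x' 2] : Fin 2 → K) i) ≤ 1 := fun i => by fin_cases i <;> simp [hx']
  have hWmem : (![x' 0, x' 2] : Fin 2 → K) ∈ stdLattice K 2 := mem_stdLattice.2 hW1
  have hboth : Valued.v (x' 1) = 1 ∧ ∃ i, Valued.v ((![x' 0, x' 2] : Fin 2 → K) i) = 1 := by
    have hline : Valued.v (σ (x' 1) * η * x' 1) = Valued.v (x' 1) * Valued.v (x' 1) := by
      rw [map_mul, map_mul, hvσ, hη, mul_one]
    obtain ⟨i, hi⟩ := hunit'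
    fin_cases i
    · have hprim : ∃ j, Valued.v ((![x' 0, x' 2] : Fin 2 → K) j) = 1 := ⟨0, by simpa using hi⟩
      have hN := valued_pairing_self_eq_one_of_primitive hvσ hanis₀ hanis₁ hWmem hprim
      rw [hNeq, Valuation.map_neg, hline] at hN
      refine ⟨?_, hprim⟩
      rcases lt_trichotomy (Valued.v (x' 1)) 1 with hlt | heq | hgt
      · exact absurd hN (ne_of_lt (mul_lt_one_of_nonneg_of_lt_one_left zero_le hlt hlt.le))
      · exact heq
      · exact absurd (hx' 1) (not_le.2 hgt)
    · have h1 : Valued.v (x' 1) = 1 := by simpa using hi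
      refine ⟨h1, ?_⟩
      have hN : Valued.v (pairing σ (Matrix.diagonal d) ![x' 0, x' 2] ![x' 0, x' 2]) = 1 := by
        rw [hNeq, Valuation.map_neg, hline, h1, one_mul]
      exact exists_valued_eq_one_of_pairing_self_eq_one hvσ hanis₀ hanis₁ hN
    · have hprim : ∃ j, Valued.v ((![x' 0, x' 2] : Fin 2 → K) j) = 1 := ⟨1, by simpa using hi⟩
      have hN := valued_pairing_self_eq_one_of_primitive hvσ hanis₀ hanis₁ hWmem hprim
      rw [hNeq, Valuation.map_neg, hline] at hN
      refine ⟨?_, hprim⟩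
      rcases lt_trichotomy (Valued.v (x' 1)) 1 with hlt | heq | hgt
      · exact absurd hN (ne_of_lt (mul_lt_one_of_nonneg_of_lt_one_left zero_le hlt hlt.le))
      · exact heq
      · exact absurd (hx' 1) (not_le.2 hgt)
  obtain ⟨hx1, hWprim⟩ := hboth
  -- `(Γ − 1)x′ − λx′ = P⁻¹(Sx − λx)` is small
  have hS : S = Pmat * (Γm - 1) * Pinv := by
    rw [hSdef, hγ, Units.val_mul, Units.val_mul, ← hPmatdef, ← hPinvdef, ← hΓmdef, Matrix.mul_sub, Matrix.sub_mul, Matrix.mul_one, hPP]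
  have hmat : Pinv * (Pmat * (Γm - 1) * Pinv) = (Γm - 1) * Pinv := by
    rw [Matrix.mul_assoc Pmat, ← Matrix.mul_assoc Pinv Pmat, hPP', Matrix.one_mul]
  have hr' : ∀ i, Valued.v ((((Γm - 1 : Matrix (Fin 3) (Fin 3) K)) *ᵥ x' - lam • x') i) ≤ Valued.v ϖ ^ (d₀ + 1) := by
    have e : ((Γm - 1 : Matrix (Fin 3) (Fin 3) K)) *ᵥ x' - lam • x' = Pinv *ᵥ (S *ᵥ x - lam • x) := by
      rw [Matrix.mulVec_sub, Matrix.mulVec_smul, ← hx'def]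
      congr 1
      rw [hS, Matrix.mulVec_mulVec, hmat, ← Matrix.mulVec_mulVec, ← hx'def]
    intro i; rw [e]; exact hmv Pinv _ _ hPi' hr i
  -- the line row: `λ ≡ u₀₀ − 1 (mod ϖ^{d₀+1})`
  have hrow : ((((Γm - 1 : Matrix (Fin 3) (Fin 3) K)) *ᵥ x' - lam • x') 1) = (((u : Matrix (Fin 1) (Fin 1) K) 0 0 - 1) - lam) * x' 1 := by
    rw [Pi.sub_apply, Pi.smul_apply, smul_eq_mul, hΓmdef, endoGL_sub_one_mulVec_apply_one]; ring
  have hlam : Valued.v (((u : Matrix (Fin 1) (Fin 1) K) 0 0 - 1) - lam) ≤ Valued.v ϖ ^ (d₀ + 1) := by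
    have h := hr' 1
    rw [hrow, map_mul, hx1, mul_one] at h
    exact h
  -- hence `T·x′_W ∈ ϖ^{d₀+1}𝒪²`: the coordinates `0`, `2` of `(Γ − u₀₀·1)x′ = ((Γ−1)x′ − λx′) − (u₀₀ − 1 − λ)x′`
  have hvec : ∀ i, ((Γm - (u : Matrix (Fin 1) (Fin 1) K) 0 0 • (1 : Matrix (Fin 3) (Fin 3) K)) *ᵥ x') i =
      ((((Γm - 1 : Matrix (Fin 3) (Fin 3) K)) *ᵥ x' - lam • x') i) - (((u : Matrix (Fin 1) (Fin 1) K) 0 0 - 1) - lam) * x' i := by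
    intro i
    simp only [Matrix.sub_mulVec, Matrix.smul_mulVec, Matrix.one_mulVec, Pi.sub_apply, Pi.smul_apply, smul_eq_mul]
    ring
  have hTx : ∀ i, Valued.v (((Γm - (u : Matrix (Fin 1) (Fin 1) K) 0 0 • (1 : Matrix (Fin 3) (Fin 3) K)) *ᵥ x') i) ≤ Valued.v ϖ ^ (d₀ + 1) := by
    intro i
    rw [hvec i]
    refine (Valuation.map_sub _ _ _).trans (max_le (hr' i) ?_)
    rw [map_mul]
    exact (mul_le_mul' hlam (hx' i)).trans (by rw [mul_one])
  have hTW := endoGL_sub_smul_one_mulVec_eq γ₁ u x'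
  rw [← hΓmdef] at hTW
  have hT0 : Valued.v ((((γ₁ : Matrix (Fin 2) (Fin 2) K) - (u : Matrix (Fin 1) (Fin 1) K) 0 0 • (1 : Matrix (Fin 2) (Fin 2) K)) *ᵥ ![x' 0, x' 2]) 0) ≤ Valued.v ϖ ^ (d₀ + 1) := by
    have h := hTx 0
    rw [hTW] at h
    simpa using h
  have hT1 : Valued.v ((((γ₁ : Matrix (Fin 2) (Fin 2) K) - (u : Matrix (Fin 1) (Fin 1) K) 0 0 • (1 : Matrix (Fin 2) (Fin 2) K)) *ᵥ ![x' 0, x' 2]) 1) ≤ Valued.v ϖ ^ (d₀ + 1) := by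
    have h := hTx 2
    rw [hTW] at h
    simpa using h
  obtain ⟨i, hi⟩ := hT ![x' 0, x' 2] hW1 hWprim
  have hsmall : Valued.v ((((γ₁ : Matrix (Fin 2) (Fin 2) K) - (u : Matrix (Fin 1) (Fin 1) K) 0 0 • (1 : Matrix (Fin 2) (Fin 2) K)) *ᵥ ![x' 0, x' 2]) i) ≤ Valued.v ϖ ^ (d₀ + 1) := by
    fin_cases i
    · exact hT0
    · exact hT1
  exact absurd (hi.trans hsmall) (not_le.2 hϖd1)

/-! ## §2 The three root slices from VALUE-ONLY line counts (★ (K2) at `v = r₀` with the eigenline clause removed by §1) -/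

set_option maxHeartbeats 1600000 in -- budget only: statement-heavy lattice tokens (★ (K2)'s).
/-- **THE ROOT CENSUS OF THE ANISOTROPIC LITERAL, LATTICE HALF (any odd root depth)** — the `hNE hNP hNM` binders of ★ `strataCount_J₀_of_charpoly_block_raw_singleton` at
`γ = P·ι(γ₁, u)·P⁻¹ ∈ K₀` (frame `ᵗσ(P)Φ₃P = ι(diag d, η)`, `diag d̄` anisotropic, `P·𝒪³ = 𝒪³`; non-contraction `hT` of `γ₁ − u₀₀·1` at depth `d₀`) from VALUE-ONLY child-line
counts: `#{GC w of r₀ ∣ ¬LEV(ϖ^{d₀}) ∧ E-token} = q·νE`, `#{… P-token ∧ CLS(c₁)} = q·νP`, `#{… P-token ∧ ¬CLS(c₁)} = q·νM`, where `νE ∕ νP ∕ νM` count the child lines `κ·N₁` (`κ ∈ K₀`)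
of value `(ϖ^{d₀})⁻¹⟨κe₀, (γ−1)κe₀⟩` null ∕ of class `−c₁` ∕ of class `−c₁ε` — ★ (K2) at `v = r₀`, `u = 1`, its eigenline clause discharged by §1.  The `hνE hνP hνM` texts are those of
★ `rootSlices_hyperbolic_of_lineCounts` CHARACTER FOR CHARACTER (★ p849383 converts them to residual-conic point counts, generic in `γ`); ALL `q + 1` lines are counted, the finite
half is F0P3a-p02's. [cite: Kottwitz1986, §3] [cite: Rogawski1990, §4.9 pp. 54–56] [cite: LabesseLanglands1979, §2] [cite: BruhatTits1972, §10] -/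
theorem rootSlices_anisotropic_of_lineCounts (hσ : ∀ x, σ (σ x) = x) (hvσ : ∀ a, Valued.v (σ a) = Valued.v a) (hσϖ : σ ϖ = -ϖ)
    (hϖ : Valued.v ϖ = WithZero.exp (-1 : ℤ)) (hres : ∀ x : K, Valued.v x ≤ 1 → Valued.v (σ x - x) < 1) (h2 : Valued.v (2 : K) = 1) [Finite 𝓀[K]]
    (hTr : (latticeGraph σ ϖ ((StdForm.antidiagonal 3).over K)).IsTree)
    {γ : unitaryGroupOfForm σ ((StdForm.antidiagonal 3).over K)} (hγ0 : γ ∈ unitaryInt σ ((StdForm.antidiagonal 3).over K))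
    {d : Fin 2 → K} {η : K} (P : GL (Fin 3) K)
    (hP : formCongr σ P ((StdForm.antidiagonal 3).over K) =
      !![(Matrix.diagonal d) 0 0, 0, (Matrix.diagonal d) 0 1; 0, η, 0; (Matrix.diagonal d) 1 0, 0, (Matrix.diagonal d) 1 1])
    (hP0 : mapGL P (stdLattice K 3) = stdLattice K 3)
    (hanis₀ : ∀ c : K, Valued.v c ≤ 1 → Valued.v (d 0 + d 1 * (σ c * c)) = 1)
    (hanis₁ : ∀ c : K, Valued.v c ≤ 1 → Valued.v (d 0 * (σ c * c) + d 1) = 1)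
    (hη : Valued.v η = 1)
    (γ₁ : GL (Fin 2) K) (u : GL (Fin 1) K) (hγ : (γ : GL (Fin 3) K) = P * endoGL (γ₁, u) * P⁻¹)
    {d₀ : ℕ} (hd3 : 3 ≤ d₀) (hodd : Odd d₀)
    (hT : ∀ y : Fin 2 → K, (∀ i, Valued.v (y i) ≤ 1) → (∃ i, Valued.v (y i) = 1) →
      ∃ i, Valued.v ϖ ^ d₀ ≤ Valued.v ((((γ₁ : Matrix (Fin 2) (Fin 2) K) - (u : Matrix (Fin 1) (Fin 1) K) 0 0 • (1 : Matrix (Fin 2) (Fin 2) K)) *ᵥ y) i))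
    (hnil3 : ∀ (w : {M : Submodule 𝒪[K] (Fin 3 → K) // IsVertex σ ϖ ((StdForm.antidiagonal 3).over K) M}) (e : ℕ), e + 1 ≤ d₀ →
      w.1.map ((Matrix.toLin' (((γ : GL (Fin 3) K) : Matrix (Fin 3) (Fin 3) K) - 1)).restrictScalars 𝒪[K]) ≤ scaleLattice (ϖ ^ e) w.1 →
      w.1.map ((Matrix.toLin' ((((γ : GL (Fin 3) K) : Matrix (Fin 3) (Fin 3) K) - 1) ^ 3)).restrictScalars 𝒪[K]) ≤ scaleLattice (ϖ ^ (3 * e + 1)) w.1)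
    (hroot : (stdLattice K 3).map ((Matrix.toLin' (((γ : GL (Fin 3) K) : Matrix (Fin 3) (Fin 3) K) - 1)).restrictScalars 𝒪[K]) ≤ scaleLattice (ϖ ^ d₀) (stdLattice K 3))
    (c₁ ε : K) (hc₁ : Valued.v c₁ = 1) (hεv : Valued.v ε = 1) (hε : ∀ z : K, Valued.v z ≤ 1 → Valued.v (z ^ 2 - ε) = 1)
    (νE νP νM : ℕ)
    (hνE : ({c : {M : Submodule 𝒪[K] (Fin 3 → K) // IsVertex σ ϖ ((StdForm.antidiagonal 3).over K) M} | (latticeGraph σ ϖ ((StdForm.antidiagonal 3).over K)).Adj (⟨stdLattice K 3, 0, isSelfDualLattice_stdLattice_three_of_v hϖ⟩ : {M : Submodule 𝒪[K] (Fin 3 → K) // IsVertex σ ϖ ((StdForm.antidiagonal 3).over K) M}) c ∧ (latticeGraph σ ϖ ((StdForm.antidiagonal 3).over K)).dist ⟨stdLattice K 3, 0, isSelfDualLattice_stdLattice_three_of_v hϖ⟩ c = (latticeGraph σ ϖ ((StdForm.antidiagonal 3).over K)).dist ⟨stdLattice K 3, 0, isSelfDualLattice_stdLattice_three_of_v hϖ⟩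 (⟨stdLattice K 3, 0, isSelfDualLattice_stdLattice_three_of_v hϖ⟩ : {M : Submodule 𝒪[K] (Fin 3 → K) // IsVertex σ ϖ ((StdForm.antidiagonal 3).over K) M}) + 1 ∧ ∃ κ : unitaryGroupOfForm σ ((StdForm.antidiagonal 3).over K), κ ∈ unitaryInt σ ((StdForm.antidiagonal 3).over K) ∧ c = latticeGraphIso σ ϖ ((StdForm.antidiagonal 3).over K) κ ⟨latt (Matrix.diagonal ![(1 : K), 1, ϖ]), 2, isVertexLattice_two_N₁_of_neg hσϖ hϖ⟩ ∧ Valued.v ((ϖ ^ d₀)⁻¹ * pairing σ ((StdForm.antidiagonal 3).over K) (((κ : GL (Fin 3) K) : Matrix (Fin 3) (Fin 3) K) *ᵥ Pi.single 0 1) ((((γ : GL (Fin 3) K) : Matrix (Fin 3) (Fin 3) K) - 1) *ᵥ (((κ : GL (Fin 3) K) : Matrix (Fin 3) (Fin 3) K) *ᵥ Pi.single 0 1))) < 1}).ncard = νE)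
    (hνP : ({c : {M : Submodule 𝒪[K] (Fin 3 → K) // IsVertex σ ϖ ((StdForm.antidiagonal 3).over K) M} | (latticeGraph σ ϖ ((StdForm.antidiagonal 3).over K)).Adj (⟨stdLattice K 3, 0, isSelfDualLattice_stdLattice_three_of_v hϖ⟩ : {M : Submodule 𝒪[K] (Fin 3 → K) // IsVertex σ ϖ ((StdForm.antidiagonal 3).over K) M}) c ∧ (latticeGraph σ ϖ ((StdForm.antidiagonal 3).over K)).dist ⟨stdLattice K 3, 0, isSelfDualLattice_stdLattice_three_of_v hϖ⟩ c = (latticeGraph σ ϖ ((StdForm.antidiagonal 3).over K)).dist ⟨stdLattice K 3, 0, isSelfDualLattice_stdLattice_three_of_v hϖ⟩ (⟨stdLattice K 3, 0, isSelfDualLattice_stdLattice_three_of_v hϖ⟩ : {M : Submodule 𝒪[K] (Fin 3 → K) // IsVertex σ ϖ ((StdForm.antidiagonal 3).over K) M}) + 1 ∧ ∃ κ : unitaryGroupOfForm σ ((StdForm.antidiagonal 3).over K), κ ∈ unitaryInt σ ((StdForm.antidiagonal 3).over K) ∧ c = latticeGraphIso σ ϖ ((StdForm.antidiagonal 3).over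 K) κ ⟨latt (Matrix.diagonal ![(1 : K), 1, ϖ]), 2, isVertexLattice_two_N₁_of_neg hσϖ hϖ⟩ ∧ (∃ a : K, Valued.v a = 1 ∧ Valued.v (((ϖ ^ d₀)⁻¹ * pairing σ ((StdForm.antidiagonal 3).over K) (((κ : GL (Fin 3) K) : Matrix (Fin 3) (Fin 3) K) *ᵥ Pi.single 0 1) ((((γ : GL (Fin 3) K) : Matrix (Fin 3) (Fin 3) K) - 1) *ᵥ (((κ : GL (Fin 3) K) : Matrix (Fin 3) (Fin 3) K) *ᵥ Pi.single 0 1))) - (-c₁) * a ^ 2) < 1)}).ncard = νP)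
    (hνM : ({c : {M : Submodule 𝒪[K] (Fin 3 → K) // IsVertex σ ϖ ((StdForm.antidiagonal 3).over K) M} | (latticeGraph σ ϖ ((StdForm.antidiagonal 3).over K)).Adj (⟨stdLattice K 3, 0, isSelfDualLattice_stdLattice_three_of_v hϖ⟩ : {M : Submodule 𝒪[K] (Fin 3 → K) // IsVertex σ ϖ ((StdForm.antidiagonal 3).over K) M}) c ∧ (latticeGraph σ ϖ ((StdForm.antidiagonal 3).over K)).dist ⟨stdLattice K 3, 0, isSelfDualLattice_stdLattice_three_of_v hϖ⟩ c = (latticeGraph σ ϖ ((StdForm.antidiagonal 3).over K)).dist ⟨stdLattice K 3, 0, isSelfDualLattice_stdLattice_three_of_v hϖ⟩ (⟨stdLattice K 3, 0, isSelfDualLattice_stdLattice_three_of_v hϖ⟩ : {M : Submodule 𝒪[K] (Fin 3 → K) // IsVertex σ ϖ ((StdForm.antidiagonal 3).over K) M}) + 1 ∧ ∃ κ : unitaryGroupOfForm σ ((StdForm.antidiagonal 3).over K), κ ∈ unitaryInt σ ((StdForm.antidiagonal 3).over K) ∧ c = latticeGraphIso σ ϖ ((StdForm.antidiagonal 3).over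 K) κ ⟨latt (Matrix.diagonal ![(1 : K), 1, ϖ]), 2, isVertexLattice_two_N₁_of_neg hσϖ hϖ⟩ ∧ (∃ a : K, Valued.v a = 1 ∧ Valued.v (((ϖ ^ d₀)⁻¹ * pairing σ ((StdForm.antidiagonal 3).over K) (((κ : GL (Fin 3) K) : Matrix (Fin 3) (Fin 3) K) *ᵥ Pi.single 0 1) ((((γ : GL (Fin 3) K) : Matrix (Fin 3) (Fin 3) K) - 1) *ᵥ (((κ : GL (Fin 3) K) : Matrix (Fin 3) (Fin 3) K) *ᵥ Pi.single 0 1))) - (-(c₁ * ε)) * a ^ 2) < 1)}).ncard = νM) :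
    ({w | w ∈ {w | ∃ c, ((latticeGraph σ ϖ ((StdForm.antidiagonal 3).over K)).Adj (⟨stdLattice K 3, 0, isSelfDualLattice_stdLattice_three_of_v hϖ⟩ : {M : Submodule 𝒪[K] (Fin 3 → K) // IsVertex σ ϖ ((StdForm.antidiagonal 3).over K) M}) c ∧ (latticeGraph σ ϖ ((StdForm.antidiagonal 3).over K)).dist ⟨stdLattice K 3, 0, isSelfDualLattice_stdLattice_three_of_v hϖ⟩ c = (latticeGraph σ ϖ ((StdForm.antidiagonal 3).over K)).dist ⟨stdLattice K 3, 0, isSelfDualLattice_stdLattice_three_of_v hϖ⟩ (⟨stdLattice K 3, 0, isSelfDualLattice_stdLattice_three_of_v hϖ⟩ : {M : Submodule 𝒪[K] (Fin 3 → K) // IsVertex σ ϖ ((StdForm.antidiagonal 3).over K) M}) + 1 ∧ latticeGraphIso σ ϖ ((StdForm.antidiagonal 3).over K) γ c = c) ∧ ((latticeGraph σ ϖ ((StdForm.antidiagonal 3).over K)).Adj c w ∧ (latticeGraph σ ϖ ((StdForm.antidiagonal 3).over K)).dist ⟨stdLattice K 3, 0, isSelfDualLattice_stdLattice_three_of_v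 hϖ⟩ w = (latticeGraph σ ϖ ((StdForm.antidiagonal 3).over K)).dist ⟨stdLattice K 3, 0, isSelfDualLattice_stdLattice_three_of_v hϖ⟩ c + 1 ∧ latticeGraphIso σ ϖ ((StdForm.antidiagonal 3).over K) γ w = w)} ∧ (¬ w.1.map ((Matrix.toLin' (((γ : GL (Fin 3) K) : Matrix (Fin 3) (Fin 3) K) - 1)).restrictScalars 𝒪[K]) ≤ scaleLattice (ϖ ^ d₀) w.1 ∧ (w.1.map ((Matrix.toLin' (((γ : GL (Fin 3) K) : Matrix (Fin 3) (Fin 3) K) - 1)).restrictScalars 𝒪[K]) ≤ scaleLattice (ϖ ^ (d₀ - 1)) w.1 ∧ ¬ w.1.map ((Matrix.toLin' (((γ : GL (Fin 3) K) : Matrix (Fin 3) (Fin 3) K) - 1)).restrictScalars 𝒪[K]) ≤ scaleLattice (ϖ ^ d₀) w.1))}).ncard = Nat.card 𝓀[K] * νE ∧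
      ({w | w ∈ {w | ∃ c, ((latticeGraph σ ϖ ((StdForm.antidiagonal 3).over K)).Adj (⟨stdLattice K 3, 0, isSelfDualLattice_stdLattice_three_of_v hϖ⟩ : {M : Submodule 𝒪[K] (Fin 3 → K) // IsVertex σ ϖ ((StdForm.antidiagonal 3).over K) M}) c ∧ (latticeGraph σ ϖ ((StdForm.antidiagonal 3).over K)).dist ⟨stdLattice K 3, 0, isSelfDualLattice_stdLattice_three_of_v hϖ⟩ c = (latticeGraph σ ϖ ((StdForm.antidiagonal 3).over K)).dist ⟨stdLattice K 3, 0, isSelfDualLattice_stdLattice_three_of_v hϖ⟩ (⟨stdLattice K 3, 0, isSelfDualLattice_stdLattice_three_of_v hϖ⟩ : {M : Submodule 𝒪[K] (Fin 3 → K) // IsVertex σ ϖ ((StdForm.antidiagonal 3).over K) M}) + 1 ∧ latticeGraphIso σ ϖ ((StdForm.antidiagonal 3).over K) γ c = c) ∧ ((latticeGraph σ ϖ ((StdForm.antidiagonal 3).over K)).Adj c w ∧ (latticeGraph σ ϖ ((StdForm.antidiagonal 3).over K)).dist ⟨stdLattice K 3, 0, isSelfDualLattice_stdLattice_three_of_v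 hϖ⟩ w = (latticeGraph σ ϖ ((StdForm.antidiagonal 3).over K)).dist ⟨stdLattice K 3, 0, isSelfDualLattice_stdLattice_three_of_v hϖ⟩ c + 1 ∧ latticeGraphIso σ ϖ ((StdForm.antidiagonal 3).over K) γ w = w)} ∧ (¬ w.1.map ((Matrix.toLin' (((γ : GL (Fin 3) K) : Matrix (Fin 3) (Fin 3) K) - 1)).restrictScalars 𝒪[K]) ≤ scaleLattice (ϖ ^ d₀) w.1 ∧ (w.1.map ((Matrix.toLin' (((γ : GL (Fin 3) K) : Matrix (Fin 3) (Fin 3) K) - 1)).restrictScalars 𝒪[K]) ≤ scaleLattice (ϖ ^ (d₀ - 2)) w.1 ∧ ¬ w.1.map ((Matrix.toLin' (((γ : GL (Fin 3) K) : Matrix (Fin 3) (Fin 3) K) - 1)).restrictScalars 𝒪[K]) ≤ scaleLattice (ϖ ^ (d₀ - 1)) w.1) ∧ ∃ y ∈ w.1, ∃ a : K, Valued.v a = 1 ∧ Valued.v ((ϖ ^ (d₀ - 2))⁻¹ * pairing σ ((StdForm.antidiagonal 3).over K) y ((((γ : GL (Fin 3) K) : Matrix (Fin 3) (Fin 3)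 K) - 1) *ᵥ y) - (c₁) * a ^ 2) < 1)}).ncard = Nat.card 𝓀[K] * νP ∧
      ({w | w ∈ {w | ∃ c, ((latticeGraph σ ϖ ((StdForm.antidiagonal 3).over K)).Adj (⟨stdLattice K 3, 0, isSelfDualLattice_stdLattice_three_of_v hϖ⟩ : {M : Submodule 𝒪[K] (Fin 3 → K) // IsVertex σ ϖ ((StdForm.antidiagonal 3).over K) M}) c ∧ (latticeGraph σ ϖ ((StdForm.antidiagonal 3).over K)).dist ⟨stdLattice K 3, 0, isSelfDualLattice_stdLattice_three_of_v hϖ⟩ c = (latticeGraph σ ϖ ((StdForm.antidiagonal 3).over K)).dist ⟨stdLattice K 3, 0, isSelfDualLattice_stdLattice_three_of_v hϖ⟩ (⟨stdLattice K 3, 0, isSelfDualLattice_stdLattice_three_of_v hϖ⟩ : {M : Submodule 𝒪[K] (Fin 3 → K) // IsVertex σ ϖ ((StdForm.antidiagonal 3).over K) M}) + 1 ∧ latticeGraphIso σ ϖ ((StdForm.antidiagonal 3).over K) γ c = c) ∧ ((latticeGraph σ ϖ ((StdForm.antidiagonal 3).over K)).Adj c w ∧ (latticeGraph σ ϖ ((StdForm.antidiagonal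 3).over K)).dist ⟨stdLattice K 3, 0, isSelfDualLattice_stdLattice_three_of_v hϖ⟩ w = (latticeGraph σ ϖ ((StdForm.antidiagonal 3).over K)).dist ⟨stdLattice K 3, 0, isSelfDualLattice_stdLattice_three_of_v hϖ⟩ c + 1 ∧ latticeGraphIso σ ϖ ((StdForm.antidiagonal 3).over K) γ w = w)} ∧ (¬ w.1.map ((Matrix.toLin' (((γ : GL (Fin 3) K) : Matrix (Fin 3) (Fin 3) K) - 1)).restrictScalars 𝒪[K]) ≤ scaleLattice (ϖ ^ d₀) w.1 ∧ (w.1.map ((Matrix.toLin' (((γ : GL (Fin 3) K) : Matrix (Fin 3) (Fin 3) K) - 1)).restrictScalars 𝒪[K]) ≤ scaleLattice (ϖ ^ (d₀ - 2)) w.1 ∧ ¬ w.1.map ((Matrix.toLin' (((γ : GL (Fin 3) K) : Matrix (Fin 3) (Fin 3) K) - 1)).restrictScalars 𝒪[K]) ≤ scaleLattice (ϖ ^ (d₀ - 1)) w.1) ∧ ¬ (∃ y ∈ w.1, ∃ a : K, Valued.v a = 1 ∧ Valued.v ((ϖ ^ (d₀ - 2))⁻¹ * pairing σ ((StdForm.antidiagonal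 3).over K) y ((((γ : GL (Fin 3) K) : Matrix (Fin 3) (Fin 3) K) - 1) *ᵥ y) - (c₁) * a ^ 2) < 1))}).ncard = Nat.card 𝓀[K] * νM := by
  have hne := fun (κ : unitaryGroupOfForm σ ((StdForm.antidiagonal 3).over K)) (hκ : κ ∈ unitaryInt σ ((StdForm.antidiagonal 3).over K)) =>
    not_eigenline_root_of_coe_eq_conj_endoGL hvσ hϖ P hP hP0 hanis₀ hanis₁ hη γ₁ u hγ hT κ hκ
  have hfix : latticeGraphIso σ ϖ ((StdForm.antidiagonal 3).over K) γ (⟨stdLattice K 3, 0, isSelfDualLattice_stdLattice_three_of_v hϖ⟩ : {M : Submodule 𝒪[K] (Fin 3 → K) // IsVertex σ ϖ ((StdForm.antidiagonal 3).over K) M}) = ⟨stdLattice K 3, 0, isSelfDualLattice_stdLattice_three_of_v hϖ⟩ := by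
    apply Subtype.ext
    rw [latticeGraphIso_apply_coe]
    exact mapGL_stdLattice_of_mem_unitaryInt hγ0
  refine offRegion_tokenSlices_of_lineCounts_of_odd hσ hvσ hσϖ hϖ hres h2 hTr hγ0 hd3 hodd hnil3 c₁ ε hc₁ hεv hε 1 (latticeGraphIso_one_apply _).symm
    (isSelfDualLattice_stdLattice_three_of_v hϖ) hfix hroot νE νP νM ?_ ?_ ?_
  · refine (congrArg Set.ncard ?_).trans hνE
    ext c
    simp only [Set.mem_setOf_eq, one_mul, inv_one, mul_one]
    constructor
    · rintro ⟨h1, h2', κ, hκ, hc, -, hv⟩; exact ⟨h1, h2', κ, hκ, hc, hv⟩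
    · rintro ⟨h1, h2', κ, hκ, hc, hv⟩; exact ⟨h1, h2', κ, hκ, hc, hne κ hκ, hv⟩
  · refine (congrArg Set.ncard ?_).trans hνP
    ext c
    simp only [Set.mem_setOf_eq, one_mul, inv_one, mul_one]
    constructor
    · rintro ⟨h1, h2', κ, hκ, hc, -, hv⟩; exact ⟨h1, h2', κ, hκ, hc, hv⟩
    · rintro ⟨h1, h2', κ, hκ, hc, hv⟩; exact ⟨h1, h2', κ, hκ, hc, hne κ hκ, hv⟩
  · refine (congrArg Set.ncard ?_).trans hνM
    ext c
    simp only [Set.mem_setOf_eq, one_mul, inv_one, mul_one]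
    constructor
    · rintro ⟨h1, h2', κ, hκ, hc, -, hv⟩; exact ⟨h1, h2', κ, hκ, hc, hv⟩
    · rintro ⟨h1, h2', κ, hκ, hc, hv⟩; exact ⟨h1, h2', κ, hκ, hc, hne κ hκ, hv⟩

/-! ## §3 The root-region package at `P·ι(γ₁, u)·P⁻¹`: `sR := {r₀}` and the three pooled sums (the `sR hsR PE PP PM hPE hPP hPM` inputs of ★ p849224 ∕ ★ p849189 ∕ ★ p849287) -/

set_option maxHeartbeats 1600000 in -- budget only: statement-heavy lattice tokens.
/-- **THE ROOT-REGION PACKAGE OF THE ANISOTROPIC LITERAL (any odd root depth)** — the `(sR, hsR, PE, PP, PM, hPE, hPP, hPM)` inputs of ★ p849224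
`strataCount_J₀_of_charpoly_block_raw_endoGL_one`-shaped heads ∕ ★ `strataCount_J₀_of_charpoly_block_raw_singleton` at `γ = P·ι(γ₁, u)·P⁻¹` with `sR := {r₀}`,
`(PE, PP, PM) := q·(νE, νP, νM)` from VALUE-ONLY root line counts: the root region is `{r₀}` by ★ F0P3a-p08's THM 4 `eq_root_of_latticeGraphIso_selfDual_lev_of_coe_eq_conj_endoGL`
(non-contraction `hT`), the slices are §2 (`q = Nat.card 𝓀`).  The finite half (which lines are null, class sums on the anisotropic root conic) is F0P3a-p02 (g18)'s; the `HS`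
bridge is the chair's (★ PART 4). (Twin of ★ `rootRegionPackage_hyperbolic_of_lineCounts`.) [cite: Kottwitz1986, §3] [cite: Rogawski1990, §4.9 pp. 54–56] [cite: LabesseLanglands1979, §2] -/
theorem rootRegionPackage_anisotropic_of_lineCounts [IsPrincipalIdealRing 𝒪[K]] (hσ : ∀ x, σ (σ x) = x) (hvσ : ∀ a, Valued.v (σ a) = Valued.v a) (hσϖ : σ ϖ = -ϖ)
    (hϖ : Valued.v ϖ = WithZero.exp (-1 : ℤ)) (hres : ∀ x : K, Valued.v x ≤ 1 → Valued.v (σ x - x) < 1) (h2 : Valued.v (2 : K) = 1) [Finite 𝓀[K]]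
    (hTr : (latticeGraph σ ϖ ((StdForm.antidiagonal 3).over K)).IsTree)
    {γ : unitaryGroupOfForm σ ((StdForm.antidiagonal 3).over K)} (hγ0 : γ ∈ unitaryInt σ ((StdForm.antidiagonal 3).over K))
    {d : Fin 2 → K} {η : K} (P : GL (Fin 3) K)
    (hP : formCongr σ P ((StdForm.antidiagonal 3).over K) =
      !![(Matrix.diagonal d) 0 0, 0, (Matrix.diagonal d) 0 1; 0, η, 0; (Matrix.diagonal d) 1 0, 0, (Matrix.diagonal d) 1 1])
    (hP0 : mapGL P (stdLattice K 3) = stdLattice K 3)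
    (hd : ∀ i, Valued.v (d i) = 1) (hdσ : ∀ i, σ (d i) = d i)
    (hanis₀ : ∀ c : K, Valued.v c ≤ 1 → Valued.v (d 0 + d 1 * (σ c * c)) = 1)
    (hanis₁ : ∀ c : K, Valued.v c ≤ 1 → Valued.v (d 0 * (σ c * c) + d 1) = 1)
    (hησ : σ η = η) (hη : Valued.v η = 1)
    (γ₁ : GL (Fin 2) K) (u : GL (Fin 1) K) (hγ : (γ : GL (Fin 3) K) = P * endoGL (γ₁, u) * P⁻¹)
    {d₀ : ℕ} (hd3 : 3 ≤ d₀) (hodd : Odd d₀)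
    (hT : ∀ y : Fin 2 → K, (∀ i, Valued.v (y i) ≤ 1) → (∃ i, Valued.v (y i) = 1) →
      ∃ i, Valued.v ϖ ^ d₀ ≤ Valued.v ((((γ₁ : Matrix (Fin 2) (Fin 2) K) - (u : Matrix (Fin 1) (Fin 1) K) 0 0 • (1 : Matrix (Fin 2) (Fin 2) K)) *ᵥ y) i))
    (hnil3 : ∀ (w : {M : Submodule 𝒪[K] (Fin 3 → K) // IsVertex σ ϖ ((StdForm.antidiagonal 3).over K) M}) (e : ℕ), e + 1 ≤ d₀ →
      w.1.map ((Matrix.toLin' (((γ : GL (Fin 3) K) : Matrix (Fin 3) (Fin 3) K) - 1)).restrictScalars 𝒪[K]) ≤ scaleLattice (ϖ ^ e) w.1 →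
      w.1.map ((Matrix.toLin' ((((γ : GL (Fin 3) K) : Matrix (Fin 3) (Fin 3) K) - 1) ^ 3)).restrictScalars 𝒪[K]) ≤ scaleLattice (ϖ ^ (3 * e + 1)) w.1)
    (hroot : (stdLattice K 3).map ((Matrix.toLin' (((γ : GL (Fin 3) K) : Matrix (Fin 3) (Fin 3) K) - 1)).restrictScalars 𝒪[K]) ≤ scaleLattice (ϖ ^ d₀) (stdLattice K 3))
    (c₁ ε : K) (hc₁ : Valued.v c₁ = 1) (hεv : Valued.v ε = 1) (hε : ∀ z : K, Valued.v z ≤ 1 → Valued.v (z ^ 2 - ε) = 1)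
    (νE νP νM : ℕ)
    (hνE : ({c : {M : Submodule 𝒪[K] (Fin 3 → K) // IsVertex σ ϖ ((StdForm.antidiagonal 3).over K) M} | (latticeGraph σ ϖ ((StdForm.antidiagonal 3).over K)).Adj (⟨stdLattice K 3, 0, isSelfDualLattice_stdLattice_three_of_v hϖ⟩ : {M : Submodule 𝒪[K] (Fin 3 → K) // IsVertex σ ϖ ((StdForm.antidiagonal 3).over K) M}) c ∧ (latticeGraph σ ϖ ((StdForm.antidiagonal 3).over K)).dist ⟨stdLattice K 3, 0, isSelfDualLattice_stdLattice_three_of_v hϖ⟩ c = (latticeGraph σ ϖ ((StdForm.antidiagonal 3).over K)).dist ⟨stdLattice K 3, 0, isSelfDualLattice_stdLattice_three_of_v hϖ⟩ (⟨stdLattice K 3, 0, isSelfDualLattice_stdLattice_three_of_v hϖ⟩ : {M : Submodule 𝒪[K] (Fin 3 → K) // IsVertex σ ϖ ((StdForm.antidiagonal 3).over K) M}) + 1 ∧ ∃ κ : unitaryGroupOfForm σ ((StdForm.antidiagonal 3).over K), κ ∈ unitaryInt σ ((StdForm.antidiagonal 3).over K) ∧ c = latticeGraphIso σ ϖ ((StdForm.antidiagonal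 3).over K) κ ⟨latt (Matrix.diagonal ![(1 : K), 1, ϖ]), 2, isVertexLattice_two_N₁_of_neg hσϖ hϖ⟩ ∧ Valued.v ((ϖ ^ d₀)⁻¹ * pairing σ ((StdForm.antidiagonal 3).over K) (((κ : GL (Fin 3) K) : Matrix (Fin 3) (Fin 3) K) *ᵥ Pi.single 0 1) ((((γ : GL (Fin 3) K) : Matrix (Fin 3) (Fin 3) K) - 1) *ᵥ (((κ : GL (Fin 3) K) : Matrix (Fin 3) (Fin 3) K) *ᵥ Pi.single 0 1))) < 1}).ncard = νE)
    (hνP : ({c : {M : Submodule 𝒪[K] (Fin 3 → K) // IsVertex σ ϖ ((StdForm.antidiagonal 3).over K) M} | (latticeGraph σ ϖ ((StdForm.antidiagonal 3).over K)).Adj (⟨stdLattice K 3, 0, isSelfDualLattice_stdLattice_three_of_v hϖ⟩ : {M : Submodule 𝒪[K] (Fin 3 → K) // IsVertex σ ϖ ((StdForm.antidiagonal 3).over K) M}) c ∧ (latticeGraph σ ϖ ((StdForm.antidiagonal 3).over K)).dist ⟨stdLattice K 3, 0, isSelfDualLattice_stdLattice_three_of_v hϖ⟩ c = (latticeGraph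 σ ϖ ((StdForm.antidiagonal 3).over K)).dist ⟨stdLattice K 3, 0, isSelfDualLattice_stdLattice_three_of_v hϖ⟩ (⟨stdLattice K 3, 0, isSelfDualLattice_stdLattice_three_of_v hϖ⟩ : {M : Submodule 𝒪[K] (Fin 3 → K) // IsVertex σ ϖ ((StdForm.antidiagonal 3).over K) M}) + 1 ∧ ∃ κ : unitaryGroupOfForm σ ((StdForm.antidiagonal 3).over K), κ ∈ unitaryInt σ ((StdForm.antidiagonal 3).over K) ∧ c = latticeGraphIso σ ϖ ((StdForm.antidiagonal 3).over K) κ ⟨latt (Matrix.diagonal ![(1 : K), 1, ϖ]), 2, isVertexLattice_two_N₁_of_neg hσϖ hϖ⟩ ∧ (∃ a : K, Valued.v a = 1 ∧ Valued.v (((ϖ ^ d₀)⁻¹ * pairing σ ((StdForm.antidiagonal 3).over K) (((κ : GL (Fin 3) K) : Matrix (Fin 3) (Fin 3) K) *ᵥ Pi.single 0 1) ((((γ : GL (Fin 3) K) : Matrix (Fin 3) (Fin 3) K) - 1) *ᵥ (((κ : GL (Fin 3) K) : Matrix (Fin 3) (Fin 3) K) *ᵥ Pi.single 0 1))) - (-c₁)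 * a ^ 2) < 1)}).ncard = νP)
    (hνM : ({c : {M : Submodule 𝒪[K] (Fin 3 → K) // IsVertex σ ϖ ((StdForm.antidiagonal 3).over K) M} | (latticeGraph σ ϖ ((StdForm.antidiagonal 3).over K)).Adj (⟨stdLattice K 3, 0, isSelfDualLattice_stdLattice_three_of_v hϖ⟩ : {M : Submodule 𝒪[K] (Fin 3 → K) // IsVertex σ ϖ ((StdForm.antidiagonal 3).over K) M}) c ∧ (latticeGraph σ ϖ ((StdForm.antidiagonal 3).over K)).dist ⟨stdLattice K 3, 0, isSelfDualLattice_stdLattice_three_of_v hϖ⟩ c = (latticeGraph σ ϖ ((StdForm.antidiagonal 3).over K)).dist ⟨stdLattice K 3, 0, isSelfDualLattice_stdLattice_three_of_v hϖ⟩ (⟨stdLattice K 3, 0, isSelfDualLattice_stdLattice_three_of_v hϖ⟩ : {M : Submodule 𝒪[K] (Fin 3 → K) // IsVertex σ ϖ ((StdForm.antidiagonal 3).over K) M}) + 1 ∧ ∃ κ : unitaryGroupOfForm σ ((StdForm.antidiagonal 3).over K), κ ∈ unitaryInt σ ((StdForm.antidiagonal 3).over K) ∧ c = latticeGraphIso σ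 ϖ ((StdForm.antidiagonal 3).over K) κ ⟨latt (Matrix.diagonal ![(1 : K), 1, ϖ]), 2, isVertexLattice_two_N₁_of_neg hσϖ hϖ⟩ ∧ (∃ a : K, Valued.v a = 1 ∧ Valued.v (((ϖ ^ d₀)⁻¹ * pairing σ ((StdForm.antidiagonal 3).over K) (((κ : GL (Fin 3) K) : Matrix (Fin 3) (Fin 3) K) *ᵥ Pi.single 0 1) ((((γ : GL (Fin 3) K) : Matrix (Fin 3) (Fin 3) K) - 1) *ᵥ (((κ : GL (Fin 3) K) : Matrix (Fin 3) (Fin 3) K) *ᵥ Pi.single 0 1))) - (-(c₁ * ε)) * a ^ 2) < 1)}).ncard = νM) :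
    (∀ v, v ∈ ({⟨stdLattice K 3, 0, isSelfDualLattice_stdLattice_three_of_v hϖ⟩} : Finset {M : Submodule 𝒪[K] (Fin 3 → K) // IsVertex σ ϖ ((StdForm.antidiagonal 3).over K) M}) ↔ v ∈ {v : {M : Submodule 𝒪[K] (Fin 3 → K) // IsVertex σ ϖ ((StdForm.antidiagonal 3).over K) M} | latticeGraphIso σ ϖ ((StdForm.antidiagonal 3).over K) γ v = v ∧ IsSelfDualLattice σ ϖ ((StdForm.antidiagonal 3).over K) v.1 ∧ v.1.map ((Matrix.toLin' (((γ : GL (Fin 3) K) : Matrix (Fin 3) (Fin 3) K) - 1)).restrictScalars 𝒪[K]) ≤ scaleLattice (ϖ ^ d₀) v.1}) ∧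
    (∑ v ∈ ({⟨stdLattice K 3, 0, isSelfDualLattice_stdLattice_three_of_v hϖ⟩} : Finset {M : Submodule 𝒪[K] (Fin 3 → K) // IsVertex σ ϖ ((StdForm.antidiagonal 3).over K) M}), ({w | w ∈ {w | ∃ c, ((latticeGraph σ ϖ ((StdForm.antidiagonal 3).over K)).Adj v c ∧ (latticeGraph σ ϖ ((StdForm.antidiagonal 3).over K)).dist ⟨stdLattice K 3, 0, isSelfDualLattice_stdLattice_three_of_v hϖ⟩ c = (latticeGraph σ ϖ ((StdForm.antidiagonal 3).over K)).dist ⟨stdLattice K 3, 0, isSelfDualLattice_stdLattice_three_of_v hϖ⟩ v + 1 ∧ latticeGraphIso σ ϖ ((StdForm.antidiagonal 3).over K) γ c = c) ∧ ((latticeGraph σ ϖ ((StdForm.antidiagonal 3).over K)).Adj c w ∧ (latticeGraph σ ϖ ((StdForm.antidiagonal 3).over K)).dist ⟨stdLattice K 3, 0, isSelfDualLattice_stdLattice_three_of_v hϖ⟩ w = (latticeGraph σ ϖ ((StdForm.antidiagonal 3).over K)).dist ⟨stdLattice K 3, 0, isSelfDualLattice_stdLattice_three_of_v hϖ⟩ c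 + 1 ∧ latticeGraphIso σ ϖ ((StdForm.antidiagonal 3).over K) γ w = w)} ∧ (¬ w.1.map ((Matrix.toLin' (((γ : GL (Fin 3) K) : Matrix (Fin 3) (Fin 3) K) - 1)).restrictScalars 𝒪[K]) ≤ scaleLattice (ϖ ^ d₀) w.1 ∧ (w.1.map ((Matrix.toLin' (((γ : GL (Fin 3) K) : Matrix (Fin 3) (Fin 3) K) - 1)).restrictScalars 𝒪[K]) ≤ scaleLattice (ϖ ^ (d₀ - 1)) w.1 ∧ ¬ w.1.map ((Matrix.toLin' (((γ : GL (Fin 3) K) : Matrix (Fin 3) (Fin 3) K) - 1)).restrictScalars 𝒪[K]) ≤ scaleLattice (ϖ ^ d₀) w.1))}).ncard = Nat.card 𝓀[K] * νE) ∧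
    (∑ v ∈ ({⟨stdLattice K 3, 0, isSelfDualLattice_stdLattice_three_of_v hϖ⟩} : Finset {M : Submodule 𝒪[K] (Fin 3 → K) // IsVertex σ ϖ ((StdForm.antidiagonal 3).over K) M}), ({w | w ∈ {w | ∃ c, ((latticeGraph σ ϖ ((StdForm.antidiagonal 3).over K)).Adj v c ∧ (latticeGraph σ ϖ ((StdForm.antidiagonal 3).over K)).dist ⟨stdLattice K 3, 0, isSelfDualLattice_stdLattice_three_of_v hϖ⟩ c = (latticeGraph σ ϖ ((StdForm.antidiagonal 3).over K)).dist ⟨stdLattice K 3, 0, isSelfDualLattice_stdLattice_three_of_v hϖ⟩ v + 1 ∧ latticeGraphIso σ ϖ ((StdForm.antidiagonal 3).over K) γ c = c) ∧ ((latticeGraph σ ϖ ((StdForm.antidiagonal 3).over K)).Adj c w ∧ (latticeGraph σ ϖ ((StdForm.antidiagonal 3).over K)).dist ⟨stdLattice K 3, 0, isSelfDualLattice_stdLattice_three_of_v hϖ⟩ w = (latticeGraph σ ϖ ((StdForm.antidiagonal 3).over K)).dist ⟨stdLattice K 3, 0, isSelfDualLattice_stdLattice_three_of_v hϖ⟩ c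 + 1 ∧ latticeGraphIso σ ϖ ((StdForm.antidiagonal 3).over K) γ w = w)} ∧ (¬ w.1.map ((Matrix.toLin' (((γ : GL (Fin 3) K) : Matrix (Fin 3) (Fin 3) K) - 1)).restrictScalars 𝒪[K]) ≤ scaleLattice (ϖ ^ d₀) w.1 ∧ (w.1.map ((Matrix.toLin' (((γ : GL (Fin 3) K) : Matrix (Fin 3) (Fin 3) K) - 1)).restrictScalars 𝒪[K]) ≤ scaleLattice (ϖ ^ (d₀ - 2)) w.1 ∧ ¬ w.1.map ((Matrix.toLin' (((γ : GL (Fin 3) K) : Matrix (Fin 3) (Fin 3) K) - 1)).restrictScalars 𝒪[K]) ≤ scaleLattice (ϖ ^ (d₀ - 1)) w.1) ∧ ∃ y ∈ w.1, ∃ a : K, Valued.v a = 1 ∧ Valued.v ((ϖ ^ (d₀ - 2))⁻¹ * pairing σ ((StdForm.antidiagonal 3).over K) y ((((γ : GL (Fin 3) K) : Matrix (Fin 3) (Fin 3) K) - 1) *ᵥ y) - (c₁) * a ^ 2) < 1)}).ncard = Nat.card 𝓀[K] * νP) ∧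
    (∑ v ∈ ({⟨stdLattice K 3, 0, isSelfDualLattice_stdLattice_three_of_v hϖ⟩} : Finset {M : Submodule 𝒪[K] (Fin 3 → K) // IsVertex σ ϖ ((StdForm.antidiagonal 3).over K) M}), ({w | w ∈ {w | ∃ c, ((latticeGraph σ ϖ ((StdForm.antidiagonal 3).over K)).Adj v c ∧ (latticeGraph σ ϖ ((StdForm.antidiagonal 3).over K)).dist ⟨stdLattice K 3, 0, isSelfDualLattice_stdLattice_three_of_v hϖ⟩ c = (latticeGraph σ ϖ ((StdForm.antidiagonal 3).over K)).dist ⟨stdLattice K 3, 0, isSelfDualLattice_stdLattice_three_of_v hϖ⟩ v + 1 ∧ latticeGraphIso σ ϖ ((StdForm.antidiagonal 3).over K) γ c = c) ∧ ((latticeGraph σ ϖ ((StdForm.antidiagonal 3).over K)).Adj c w ∧ (latticeGraph σ ϖ ((StdForm.antidiagonal 3).over K)).dist ⟨stdLattice K 3, 0, isSelfDualLattice_stdLattice_three_of_v hϖ⟩ w = (latticeGraph σ ϖ ((StdForm.antidiagonal 3).over K)).dist ⟨stdLattice K 3, 0, isSelfDualLattice_stdLattice_three_of_v hϖ⟩ c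 + 1 ∧ latticeGraphIso σ ϖ ((StdForm.antidiagonal 3).over K) γ w = w)} ∧ (¬ w.1.map ((Matrix.toLin' (((γ : GL (Fin 3) K) : Matrix (Fin 3) (Fin 3) K) - 1)).restrictScalars 𝒪[K]) ≤ scaleLattice (ϖ ^ d₀) w.1 ∧ (w.1.map ((Matrix.toLin' (((γ : GL (Fin 3) K) : Matrix (Fin 3) (Fin 3) K) - 1)).restrictScalars 𝒪[K]) ≤ scaleLattice (ϖ ^ (d₀ - 2)) w.1 ∧ ¬ w.1.map ((Matrix.toLin' (((γ : GL (Fin 3) K) : Matrix (Fin 3) (Fin 3) K) - 1)).restrictScalars 𝒪[K]) ≤ scaleLattice (ϖ ^ (d₀ - 1)) w.1) ∧ ¬ (∃ y ∈ w.1, ∃ a : K, Valued.v a = 1 ∧ Valued.v ((ϖ ^ (d₀ - 2))⁻¹ * pairing σ ((StdForm.antidiagonal 3).over K) y ((((γ : GL (Fin 3) K) : Matrix (Fin 3) (Fin 3) K) - 1) *ᵥ y) - (c₁) * a ^ 2) < 1))}).ncard = Nat.card 𝓀[K] * νM) := by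
  have hϖ0' : Valued.v ϖ ≠ 0 := by rw [hϖ]; exact WithZero.exp_ne_zero
  have hϖ0 : ϖ ≠ 0 := fun h0 => by rw [h0, map_zero] at hϖ0'; exact hϖ0' rfl
  have hR := eq_root_of_latticeGraphIso_selfDual_lev_of_coe_eq_conj_endoGL hσ hvσ hϖ P hP hP0 hd hdσ hanis₀ hanis₁ hησ hη γ hγ0 γ₁ u hγ hT hroot
  obtain ⟨hE, hPs, hMs⟩ := rootSlices_anisotropic_of_lineCounts hσ hvσ hσϖ hϖ hres h2 hTr hγ0 P hP hP0 hanis₀ hanis₁ hη γ₁ u hγ hd3 hodd hT hnil3 hroot c₁ ε hc₁ hεv hε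
    νE νP νM hνE hνP hνM
  have hfix : latticeGraphIso σ ϖ ((StdForm.antidiagonal 3).over K) γ (⟨stdLattice K 3, 0, isSelfDualLattice_stdLattice_three_of_v hϖ⟩ : {M : Submodule 𝒪[K] (Fin 3 → K) // IsVertex σ ϖ ((StdForm.antidiagonal 3).over K) M}) = ⟨stdLattice K 3, 0, isSelfDualLattice_stdLattice_three_of_v hϖ⟩ := by
    apply Subtype.ext
    rw [latticeGraphIso_apply_coe]
    exact mapGL_stdLattice_of_mem_unitaryInt hγ0
  refine ⟨fun v => ⟨fun hv => ?_, fun hv => ?_⟩, ?_, ?_, ?_⟩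
  · rw [Finset.mem_singleton] at hv
    rw [hv]
    exact ⟨hfix, isSelfDualLattice_stdLattice_three_of_v hϖ, hroot⟩
  · rw [Finset.mem_singleton]; exact hR v hv
  · rw [Finset.sum_singleton]; exact hE
  · rw [Finset.sum_singleton]; exact hPs
  · rw [Finset.sum_singleton]; exact hMs

end Literature.NumberTheory.Rogawski1990.TypeOneRamifiedJunction

end
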